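import Mathlib
import Literature.Analysis.Complex.HolomorphicParametricIntegral
import Literature.Analysis.Complex.AnalyticCharFunExpMoments
import HarnessLib

/-!
# Laplace–Fourier transforms of energy–momentum measures: cone support and the light-cone tube

Topic `Literature/Analysis/Complex`.  Let `μ` be a finite positive Borel measure on `ℝ²`, read as a
joint energy–momentum distribution `(E, P) = (p 0, p 1)` (e.g. the joint spectral measure of a
vector for a commuting pair `e^{-tH}`, `e^{isP}`, `Literature.Analysis.OperatorTheory.IsEnergyMomentumPair`).
Its Laplace–Fourier transform is `(τ, σ) ↦ ∫ e^{-τE + iσP} dμ`.  Everything here is elementary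
measure theory plus two inputs: the dominated holomorphic parameter integral
(`Literature.Analysis.Complex.differentiableOn_integral_of_dominated`) and Lukacs' theorem on
analytic characteristic functions (`Literature.Analysis.Complex.integral_exp_mul_le_of_charFun_eq`).

* `norm_cexp_laplaceFourier`, `norm_cexp_laplaceFourier_le_one` — `|e^{-τE + iσP}| = e^{-Re τ E - Im σ P} ≤ 1`
  on the cone `|P| ≤ E` when `|Im σ| ≤ Re τ`.
* **Support pinning** `measure_cone_compl_eq_zero_of_integral_exp_le`: if for all large `t` and all
  `|β| < t - C` the exponential moments `∫ e^{-tE + βP} dμ` are bounded by one constant `M`, then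
  `μ {E < |P|} = 0` — on `{E + δ ≤ |P| ≤ N}` the integrand at `β = t - C'` is at least
  `e^{tδ - C'N} → ∞`.  (The light-cone step of Glimm–Jaffe, *Quantum Physics* §19.5, run backwards.)
* **The holomorphic transform on the tube** (cone support assumed): integrability and the bound
  `‖∫ e^{-τE + iσP} dμ‖ ≤ μ(ℝ²)` for `|Im σ| ≤ Re τ` (`norm_integral_cexp_laplaceFourier_le`), joint
  holomorphy on the open tube `{|Im σ| < Re τ}` (`differentiableOn_integral_cexp_laplaceFourier`),
  and the real diagonal values `∫ e^{-tE - βP} dμ ∈ [0, μ(ℝ²)]`.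
* **From a disc of analyticity to exponential moments** `integral_exp_le_of_laplaceFourier_eq_on_ball`:
  if `s ↦ ∫ e^{-tE + isP} dμ` agrees on `(-R, R)` with a function holomorphic and bounded by `M` on
  the disc `|s| < R`, then `∫ e^{-tE + βP} dμ ≤ M` for `|β| < R` (Lukacs' theorem applied to the
  `P`-marginal of `e^{-tE} μ`).

NOT here: operators, the spectral theorem, uniqueness of `μ`.  All statements are folklore.

## References
* J. Glimm, A. Jaffe, *Quantum Physics* (2nd ed. 1987), §19.5 (light cone of the energy–momentum
  spectrum). [folklore]
* E. Lukacs, *Characteristic Functions* (2nd ed. 1970), Thm. 7.1.1. [folklore]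
-/

noncomputable section

open _root_.MeasureTheory _root_.Complex Set Filter Metric
open scoped _root_.Topology ENNReal NNReal

namespace Literature.Analysis.Complex

variable {μ : Measure (EuclideanSpace ℝ (Fin 2))}

/-! ### The kernel `e^{-τE + iσP}` -/

/-- `|e^{-τE + iσP}| = e^{-Re τ · E - Im σ · P}`. [folklore] -/
theorem norm_cexp_laplaceFourier (τ σ : ℂ) (p : EuclideanSpace ℝ (Fin 2)) :
    ‖cexp (-(τ * p 0) + I * σ * p 1)‖ = Real.exp (-(τ.re * p 0) - σ.im * p 1) := by
  rw [Complex.norm_exp]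
  congr 1
  simp only [add_re, neg_re, mul_re, ofReal_re, ofReal_im, mul_zero, sub_zero, I_re, zero_mul, I_im,
    one_mul, zero_sub, mul_im]
  ring

/-- On the cone `|P| ≤ E` and for `|Im σ| ≤ Re τ`, `|e^{-τE + iσP}| ≤ 1`. [folklore] -/
theorem norm_cexp_laplaceFourier_le_one {τ σ : ℂ} (h : |σ.im| ≤ τ.re) {p : EuclideanSpace ℝ (Fin 2)}
    (hp : |p 1| ≤ p 0) : ‖cexp (-(τ * p 0) + I * σ * p 1)‖ ≤ 1 := by
  rw [norm_cexp_laplaceFourier, Real.exp_le_one_iff]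
  have h1 : -(σ.im * p 1) ≤ |σ.im| * |p 1| := by
    rw [← abs_mul]; exact neg_le_abs _
  have h2 : |σ.im| * |p 1| ≤ τ.re * p 0 :=
    mul_le_mul h hp (abs_nonneg _) ((abs_nonneg _).trans h)
  linarith

/-- The kernel is continuous in `p`. [folklore] -/
theorem continuous_cexp_laplaceFourier (τ σ : ℂ) :
    Continuous fun p : EuclideanSpace ℝ (Fin 2) => cexp (-(τ * p 0) + I * σ * p 1) := by
  fun_prop

/-- The kernel is jointly holomorphic in `(τ, σ)`. [folklore] -/
theorem differentiable_cexp_laplaceFourier (p : EuclideanSpace ℝ (Fin 2)) :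
    Differentiable ℂ fun q : ℂ × ℂ => cexp (-(q.1 * p 0) + I * q.2 * p 1) := by
  fun_prop

/-! ### Support pinning from bounded exponential moments -/

/-- Pointwise lower bound used in the pinning argument: on `{E + δ ≤ |P| ≤ N}`, for `t ≥ 0` and
`c ≥ 0`, `e^{tδ - cN} ≤ e^{-tE + (t - c)|P|}`. [folklore] -/
theorem exp_le_exp_neg_add_abs {t c δ N E P : ℝ} (ht : 0 ≤ t) (hc : 0 ≤ c) (hδ : E + δ ≤ |P|)
    (hN : |P| ≤ N) : Real.exp (t * δ - c * N) ≤ Real.exp (-(t * E) + (t - c) * |P|) := by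
  refine Real.exp_le_exp.2 ?_
  nlinarith [abs_nonneg P]

/-- `e^{a + β|P|} ≤ e^{a + βP} + e^{a + (-β)P}`. [folklore] -/
theorem exp_add_mul_abs_le (a β P : ℝ) :
    Real.exp (a + β * |P|) ≤ Real.exp (a + β * P) + Real.exp (a + -β * P) := by
  rcases le_or_gt 0 P with hP | hP
  · rw [abs_of_nonneg hP]; linarith [Real.exp_pos (a + -β * P)]
  · rw [abs_of_neg hP, show a + β * -P = a + -β * P by ring]; linarith [Real.exp_pos (a + β * P)]

/-- The pieces `{E + 1/(j+1) ≤ |P| ≤ j + 1}` cover `{E < |P|}`. [folklore] -/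
theorem setOf_lt_abs_subset_iUnion :
    {p : EuclideanSpace ℝ (Fin 2) | p 0 < |p 1|} ⊆
      ⋃ j : ℕ, {p | p 0 + 1 / (j + 1) ≤ |p 1| ∧ |p 1| ≤ j + 1} := by
  intro p hp
  simp only [mem_setOf_eq] at hp
  have hpos : 0 < |p 1| - p 0 := by linarith
  obtain ⟨j, hj⟩ := exists_nat_gt (max (1 / (|p 1| - p 0)) |p 1|)
  have hj1 : 1 / (|p 1| - p 0) < j + 1 := by linarith [le_max_left (1 / (|p 1| - p 0)) |p 1|]
  have hj2 : |p 1| < j + 1 := by linarith [le_max_right (1 / (|p 1| - p 0)) |p 1|]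
  refine mem_iUnion.2 ⟨j, ?_, hj2.le⟩
  have h3 : 1 / ((j : ℝ) + 1) < |p 1| - p 0 := by
    rw [div_lt_iff₀ hpos] at hj1
    rw [div_lt_iff₀ (by positivity)]
    linarith
  show p 0 + 1 / ((j : ℝ) + 1) ≤ |p 1|
  linarith

/-- **Support pinning.**  Let `μ` be a finite measure on `ℝ²`.  If there are `C, M, t₀` such that
for every `t ≥ t₀` and every real `β` with `|β| < t - C` the function `e^{-tE + βP}` is integrable
with `∫ e^{-tE + βP} dμ ≤ M`, then `μ` is carried by the cone `{|P| ≤ E}`: `μ {E < |P|} = 0`.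
(Glimm–Jaffe 1987, §19.5, the light-cone corollary 19.5.4 run backwards: the mass of
`{E + δ ≤ |P| ≤ N}` times `e^{tδ - (C+1)N}` stays below `2M` as `t → ∞`.) [folklore] -/
theorem measure_cone_compl_eq_zero_of_integral_exp_le [IsFiniteMeasure μ] {C M t₀ : ℝ}
    (h : ∀ t : ℝ, t₀ ≤ t → ∀ β : ℝ, |β| < t - C →
      Integrable (fun p : EuclideanSpace ℝ (Fin 2) => Real.exp (-(t * p 0) + β * p 1)) μ ∧
        ∫ p, Real.exp (-(t * p 0) + β * p 1) ∂μ ≤ M) :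
    μ {p | p 0 < |p 1|} = 0 := by
  refine measure_mono_null setOf_lt_abs_subset_iUnion ((measure_iUnion_null_iff).2 fun j => ?_)
  by_contra hne
  have hm : 0 < μ.real {p : EuclideanSpace ℝ (Fin 2) | p 0 + 1 / (j + 1) ≤ |p 1| ∧ |p 1| ≤ j + 1} :=
    ENNReal.toReal_pos hne (measure_ne_top μ _)
  have hAm : MeasurableSet {p : EuclideanSpace ℝ (Fin 2) | p 0 + 1 / (j + 1) ≤ |p 1| ∧ |p 1| ≤ j + 1} :=
    (measurableSet_le (f := fun p : EuclideanSpace ℝ (Fin 2) => p 0 + 1 / (j + 1))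
      (g := fun p : EuclideanSpace ℝ (Fin 2) => |p 1|) (by fun_prop) (by fun_prop)).inter
      (measurableSet_le (f := fun p : EuclideanSpace ℝ (Fin 2) => |p 1|)
        (g := fun _ : EuclideanSpace ℝ (Fin 2) => (j : ℝ) + 1) (by fun_prop) (by fun_prop))
  -- the constants
  have hc0 : 0 ≤ max C 0 + 1 := by positivity
  have hδ0 : (0 : ℝ) < 1 / (j + 1) := by positivity
  -- choose `t` large
  have htend : Tendsto (fun t : ℝ => Real.exp (t * (1 / (j + 1)) - (max C 0 + 1) * (j + 1))) atTop atTop := by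
    refine Real.tendsto_exp_atTop.comp ?_
    have := tendsto_atTop_add_const_right atTop (-((max C 0 + 1) * ((j : ℝ) + 1)))
      (tendsto_id.atTop_mul_const hδ0)
    simpa [sub_eq_add_neg] using this
  obtain ⟨t, ht₁, ht₂⟩ := ((htend.eventually_gt_atTop (2 * M / μ.real {p : EuclideanSpace ℝ (Fin 2) |
    p 0 + 1 / (j + 1) ≤ |p 1| ∧ |p 1| ≤ j + 1})).and (eventually_ge_atTop (max (max t₀ (max C 0 + 1)) 0))).exists
  have ht0 : 0 ≤ t := (le_max_right _ _).trans ht₂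
  have htc : max C 0 + 1 ≤ t := ((le_max_right _ _).trans (le_max_left _ _)).trans ht₂
  have htt₀ : t₀ ≤ t := ((le_max_left _ _).trans (le_max_left _ _)).trans ht₂
  have hβ : |t - (max C 0 + 1)| < t - C := by
    rw [abs_of_nonneg (by linarith)]
    linarith [le_max_left C 0]
  obtain ⟨hi1, hI1⟩ := h t htt₀ (t - (max C 0 + 1)) hβ
  obtain ⟨hi2, hI2⟩ := h t htt₀ (-(t - (max C 0 + 1))) (by rwa [abs_neg])
  have hi3 : Integrable (fun p : EuclideanSpace ℝ (Fin 2) =>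
      Real.exp (-(t * p 0) + (t - (max C 0 + 1)) * |p 1|)) μ := by
    refine (hi1.add hi2).mono' (by fun_prop) (Eventually.of_forall fun p => ?_)
    rw [Real.norm_of_nonneg (Real.exp_pos _).le]
    exact exp_add_mul_abs_le _ _ _
  have key : Real.exp (t * (1 / (j + 1)) - (max C 0 + 1) * (j + 1)) *
      μ.real {p : EuclideanSpace ℝ (Fin 2) | p 0 + 1 / (j + 1) ≤ |p 1| ∧ |p 1| ≤ j + 1} ≤ 2 * M := by
    calc Real.exp (t * (1 / (j + 1)) - (max C 0 + 1) * (j + 1)) *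
          μ.real {p : EuclideanSpace ℝ (Fin 2) | p 0 + 1 / (j + 1) ≤ |p 1| ∧ |p 1| ≤ j + 1}
        = ∫ p in {p : EuclideanSpace ℝ (Fin 2) | p 0 + 1 / (j + 1) ≤ |p 1| ∧ |p 1| ≤ j + 1},
            Real.exp (t * (1 / (j + 1)) - (max C 0 + 1) * (j + 1)) ∂μ := by
          rw [setIntegral_const, smul_eq_mul, mul_comm]
      _ ≤ ∫ p in {p : EuclideanSpace ℝ (Fin 2) | p 0 + 1 / (j + 1) ≤ |p 1| ∧ |p 1| ≤ j + 1},
            Real.exp (-(t * p 0) + (t - (max C 0 + 1)) * |p 1|) ∂μ :=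
          setIntegral_mono_on (integrable_const _).integrableOn hi3.integrableOn hAm
            fun p hp => exp_le_exp_neg_add_abs ht0 hc0 hp.1 hp.2
      _ ≤ ∫ p, Real.exp (-(t * p 0) + (t - (max C 0 + 1)) * |p 1|) ∂μ :=
          setIntegral_le_integral hi3 (Eventually.of_forall fun p => (Real.exp_pos _).le)
      _ ≤ ∫ p, (Real.exp (-(t * p 0) + (t - (max C 0 + 1)) * p 1) +
            Real.exp (-(t * p 0) + -(t - (max C 0 + 1)) * p 1)) ∂μ :=
          integral_mono hi3 (hi1.add hi2) fun p => exp_add_mul_abs_le _ _ _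
      _ = (∫ p, Real.exp (-(t * p 0) + (t - (max C 0 + 1)) * p 1) ∂μ) +
            ∫ p, Real.exp (-(t * p 0) + -(t - (max C 0 + 1)) * p 1) ∂μ := integral_add hi1 hi2
      _ ≤ 2 * M := by linarith
  have := (div_lt_iff₀ hm).1 ht₁
  linarith

/-! ### The transform of a cone-supported measure on the light-cone tube -/

section Cone

variable [IsFiniteMeasure μ]

omit [IsFiniteMeasure μ] in
/-- Cone support a.e.: `|P| ≤ E` for `μ`-a.e. `p`. [folklore] -/
theorem ae_abs_le_of_measure_cone_compl (hcone : μ {p | p 0 < |p 1|} = 0) : ∀ᵐ p ∂μ, |p 1| ≤ p 0 := by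
  have h : ∀ᵐ p ∂μ, p ∉ {p : EuclideanSpace ℝ (Fin 2) | p 0 < |p 1|} := measure_eq_zero_iff_ae_notMem.1 hcone
  filter_upwards [h] with p hp
  simpa using hp

/-- **Integrability** of `e^{-τE + iσP}` on the closed tube `|Im σ| ≤ Re τ` for a cone-supported
finite measure. [folklore] -/
theorem integrable_cexp_laplaceFourier (hcone : μ {p | p 0 < |p 1|} = 0) {τ σ : ℂ} (h : |σ.im| ≤ τ.re) :
    Integrable (fun p : EuclideanSpace ℝ (Fin 2) => cexp (-(τ * p 0) + I * σ * p 1)) μ := by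
  refine (integrable_const (1 : ℝ)).mono' (continuous_cexp_laplaceFourier τ σ).aestronglyMeasurable ?_
  filter_upwards [ae_abs_le_of_measure_cone_compl hcone] with p hp
  exact norm_cexp_laplaceFourier_le_one h hp

/-- **The contraction bound** `‖∫ e^{-τE + iσP} dμ‖ ≤ μ(ℝ²)` on the closed tube. [folklore] -/
theorem norm_integral_cexp_laplaceFourier_le (hcone : μ {p | p 0 < |p 1|} = 0) {τ σ : ℂ}
    (h : |σ.im| ≤ τ.re) : ‖∫ p, cexp (-(τ * p 0) + I * σ * p 1) ∂μ‖ ≤ μ.real univ := by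
  calc ‖∫ p, cexp (-(τ * p 0) + I * σ * p 1) ∂μ‖ ≤ ∫ p, (1 : ℝ) ∂μ := by
        refine norm_integral_le_of_norm_le (integrable_const 1) ?_
        filter_upwards [ae_abs_le_of_measure_cone_compl hcone] with p hp
        exact norm_cexp_laplaceFourier_le_one h hp
    _ = μ.real univ := by simp

/-- **Joint holomorphy on the tube**: `(τ, σ) ↦ ∫ e^{-τE + iσP} dμ` is holomorphic on
`{|Im σ| < Re τ}` for a cone-supported finite measure (dominated holomorphic parameter integral,
bound `1`). [folklore] -/
theorem differentiableOn_integral_cexp_laplaceFourier (hcone : μ {p | p 0 < |p 1|} = 0) :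
    DifferentiableOn ℂ (fun q : ℂ × ℂ => ∫ p, cexp (-(q.1 * p 0) + I * q.2 * p 1) ∂μ)
      {q : ℂ × ℂ | |q.2.im| < q.1.re} := by
  refine differentiableOn_integral_of_dominated (fun q _ => (continuous_cexp_laplaceFourier q.1 q.2).aestronglyMeasurable)
    (Eventually.of_forall fun p => (differentiable_cexp_laplaceFourier p).differentiableOn) ?_
  intro q hq
  obtain ⟨R, hR, hball⟩ := Metric.isOpen_iff.1
    (isOpen_lt (by fun_prop) (by fun_prop) : IsOpen {q : ℂ × ℂ | |q.2.im| < q.1.re}) q hq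
  refine ⟨R, hR, hball, fun _ => 1, integrable_const 1, ?_⟩
  filter_upwards [ae_abs_le_of_measure_cone_compl hcone] with p hp q' hq'
  exact norm_cexp_laplaceFourier_le_one (le_of_lt (hball hq')) hp

omit [IsFiniteMeasure μ] in
/-- **Real diagonal values**: at `(τ, σ) = (t, iβ)` the transform is the real number
`∫ e^{-tE - βP} dμ`. [folklore] -/
theorem integral_cexp_laplaceFourier_ofReal_mul_I (t β : ℝ) :
    ∫ p, cexp (-((t : ℂ) * p 0) + I * ((β : ℂ) * I) * p 1) ∂μ =
      ((∫ p, Real.exp (-(t * p 0) - β * p 1) ∂μ : ℝ) : ℂ) := by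
  rw [← integral_complex_ofReal]
  refine integral_congr_ae (Eventually.of_forall fun p => ?_)
  simp only [Complex.ofReal_exp]
  congr 1
  have : I * ((β : ℂ) * I) = -β := by rw [mul_comm, mul_assoc, Complex.I_mul_I]; ring
  rw [this]
  push_cast
  ring

/-- The real diagonal values lie in `[0, μ(ℝ²)]` for `|β| ≤ t` (cone support). [folklore] -/
theorem integral_exp_neg_sub_mem_Icc (hcone : μ {p | p 0 < |p 1|} = 0) {t β : ℝ} (h : |β| ≤ t) :
    ∫ p, Real.exp (-(t * p 0) - β * p 1) ∂μ ∈ Icc 0 (μ.real univ) := by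
  refine ⟨integral_nonneg fun p => (Real.exp_pos _).le, ?_⟩
  have h1 := norm_integral_cexp_laplaceFourier_le hcone (τ := t) (σ := β * I) (by simpa using h)
  rw [integral_cexp_laplaceFourier_ofReal_mul_I, Complex.norm_real, Real.norm_eq_abs] at h1
  exact (le_abs_self _).trans h1

/-- **Real points**: at real `(t, s)` the kernel is `e^{-tE} e^{isP}` in the format of
`IsEnergyMomentumPair.exists_measure_inner_transfer_translate_eq_integral` (`a = s e₁`). [folklore] -/
theorem cexp_laplaceFourier_ofReal (t s : ℝ) (p : EuclideanSpace ℝ (Fin 2)) :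
    cexp (-((t : ℂ) * p 0) + I * (s : ℂ) * p 1) =
      cexp (((-(t * p 0) : ℝ) : ℂ) + ((inner ℝ (EuclideanSpace.single 1 s) p : ℝ) : ℂ) * I) := by
  rw [EuclideanSpace.inner_single_left]
  congr 1
  push_cast
  simp only [conj_trivial]
  ring

end Cone

/-! ### The half-plane in the time variable (no cone needed) -/

section HalfPlane

variable [IsFiniteMeasure μ]

/-- For real momentum parameter `a` and `Re r ≥ 0`, `|e^{-rE + iaP}| ≤ 1` on `{E ≥ 0}`. [folklore] -/
theorem norm_cexp_laplace_le_one {r : ℂ} (hr : 0 ≤ r.re) (a : ℝ) {p : EuclideanSpace ℝ (Fin 2)}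
    (hp : 0 ≤ p 0) : ‖cexp (-(r * p 0) + I * (a : ℂ) * p 1)‖ ≤ 1 := by
  rw [norm_cexp_laplaceFourier, Complex.ofReal_im, zero_mul, sub_zero, Real.exp_le_one_iff, neg_nonpos]
  exact mul_nonneg hr hp

/-- **The bound** `‖∫ e^{-rE + iaP} dμ‖ ≤ μ(ℝ²)` for `Re r ≥ 0`, real `a`, `μ {E < 0} = 0`. [folklore] -/
theorem norm_integral_cexp_laplace_le (hμ0 : μ {p | p 0 < 0} = 0) {r : ℂ} (hr : 0 ≤ r.re) (a : ℝ) :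
    ‖∫ p, cexp (-(r * p 0) + I * (a : ℂ) * p 1) ∂μ‖ ≤ μ.real univ := by
  calc ‖∫ p, cexp (-(r * p 0) + I * (a : ℂ) * p 1) ∂μ‖ ≤ ∫ p, (1 : ℝ) ∂μ := by
        refine norm_integral_le_of_norm_le (integrable_const 1) ?_
        filter_upwards [measure_eq_zero_iff_ae_notMem.1 hμ0] with p hp
        exact norm_cexp_laplace_le_one hr a (by simpa using hp)
    _ = μ.real univ := by simp

/-- **Half-plane holomorphy in the time variable**: for real `a` and `μ {E < 0} = 0`,
`r ↦ ∫ e^{-rE + iaP} dμ` is holomorphic on `{Re r > 0}` (dominated holomorphic parameter integral,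
bound `1`). [folklore] -/
theorem differentiableOn_integral_cexp_laplace (hμ0 : μ {p | p 0 < 0} = 0) (a : ℝ) :
    DifferentiableOn ℂ (fun r : ℂ => ∫ p, cexp (-(r * p 0) + I * (a : ℂ) * p 1) ∂μ) {r : ℂ | 0 < r.re} := by
  refine differentiableOn_integral_of_dominated
    (fun r _ => (continuous_cexp_laplaceFourier r a).aestronglyMeasurable)
    (Eventually.of_forall fun p => ((differentiable_cexp_laplaceFourier p).comp
      (by fun_prop : Differentiable ℂ fun r : ℂ => ((r, (a : ℂ)) : ℂ × ℂ))).differentiableOn) ?_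
  intro r hr
  obtain ⟨R, hR, hball⟩ := Metric.isOpen_iff.1 (isOpen_lt continuous_const Complex.continuous_re) r hr
  refine ⟨R, hR, hball, fun _ => 1, integrable_const 1, ?_⟩
  filter_upwards [measure_eq_zero_iff_ae_notMem.1 hμ0] with p hp r' hr'
  exact norm_cexp_laplace_le_one (le_of_lt (hball hr')) a (by simpa using hp)

end HalfPlane

/-! ### From a disc of analyticity in `s` to exponential moments in `P` -/

section Disc

variable [IsFiniteMeasure μ]

/-- The weight `e^{-tE}` as an `ℝ≥0`-valued density. [folklore] -/
theorem measurable_toNNReal_exp_neg (t : ℝ) :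
    Measurable fun p : EuclideanSpace ℝ (Fin 2) => (Real.exp (-(t * p 0))).toNNReal := by
  fun_prop

/-- The weighted measure `e^{-tE} μ` is finite for `t ≥ 0` when `μ {E < 0} = 0`. [folklore] -/
theorem isFiniteMeasure_withDensity_exp_neg (hμ0 : μ {p | p 0 < 0} = 0) {t : ℝ} (ht : 0 ≤ t) :
    IsFiniteMeasure (μ.withDensity fun p => ((Real.exp (-(t * p 0))).toNNReal : ℝ≥0∞)) := by
  refine isFiniteMeasure_withDensity (ne_of_lt ?_)
  have hae : ∀ᵐ p ∂μ, ((Real.exp (-(t * p 0))).toNNReal : ℝ≥0∞) ≤ 1 := by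
    have h : ∀ᵐ p ∂μ, p ∉ {p : EuclideanSpace ℝ (Fin 2) | p 0 < 0} := measure_eq_zero_iff_ae_notMem.1 hμ0
    filter_upwards [h] with p hp
    simp only [not_lt] at hp
    have : Real.exp (-(t * p 0)) ≤ 1 := Real.exp_le_one_iff.2 (by nlinarith)
    exact_mod_cast Real.toNNReal_le_one.2 this
  calc ∫⁻ p, ((Real.exp (-(t * p 0))).toNNReal : ℝ≥0∞) ∂μ ≤ ∫⁻ _, 1 ∂μ := lintegral_mono_ae hae
    _ = μ univ := by simp
    _ < ∞ := measure_lt_top μ _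

/-- **Exponential moments from a disc of analyticity.**  Let `μ` be a finite measure on `ℝ²` with
`μ {E < 0} = 0`, `t ≥ 0`, and suppose `s ↦ ∫ e^{-tE + isP} dμ` agrees on `(-R, R)` with a function
`h` holomorphic on the disc `|s| < R` and bounded there by `M`.  Then for every `|β| < R` the
function `e^{-tE + βP}` is `μ`-integrable and `∫ e^{-tE + βP} dμ ≤ M` (Lukacs' theorem
`integral_exp_mul_le_of_charFun_eq` for the `P`-marginal of `e^{-tE} μ`). [folklore] -/
theorem integral_exp_le_of_laplaceFourier_eq_on_ball (hμ0 : μ {p | p 0 < 0} = 0) {t : ℝ} (ht : 0 ≤ t)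
    {R M : ℝ} (hR : 0 < R) {h : ℂ → ℂ} (hh : DifferentiableOn ℂ h (ball 0 R))
    (hM : ∀ z ∈ ball (0 : ℂ) R, ‖h z‖ ≤ M)
    (heq : ∀ s : ℝ, |s| < R → h s = ∫ p, cexp (-((t : ℂ) * p 0) + I * (s : ℂ) * p 1) ∂μ)
    {β : ℝ} (hβ : |β| < R) :
    Integrable (fun p : EuclideanSpace ℝ (Fin 2) => Real.exp (-(t * p 0) + β * p 1)) μ ∧
      ∫ p, Real.exp (-(t * p 0) + β * p 1) ∂μ ≤ M := by
  -- the weighted measure and its `P`-marginal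
  set w : EuclideanSpace ℝ (Fin 2) → ℝ≥0 := fun p => (Real.exp (-(t * p 0))).toNNReal with hw
  have hwm : Measurable w := measurable_toNNReal_exp_neg t
  have hwval : ∀ p, (w p : ℝ) = Real.exp (-(t * p 0)) := fun p => Real.coe_toNNReal _ (Real.exp_pos _).le
  haveI : IsFiniteMeasure (μ.withDensity fun p => (w p : ℝ≥0∞)) := isFiniteMeasure_withDensity_exp_neg hμ0 ht
  set ν : Measure ℝ := (μ.withDensity fun p => (w p : ℝ≥0∞)).map (fun p => p 1) with hν
  have hπ : Measurable fun p : EuclideanSpace ℝ (Fin 2) => p 1 := by fun_prop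
  haveI : IsFiniteMeasure ν := Measure.isFiniteMeasure_map _ _
  -- integrals against `ν`
  have hνint : ∀ g : ℝ → ℂ, Continuous g →
      ∫ x, g x ∂ν = ∫ p, ((Real.exp (-(t * p 0)) : ℝ) : ℂ) * g (p 1) ∂μ := by
    intro g hg
    rw [hν, integral_map hπ.aemeasurable hg.aestronglyMeasurable, integral_withDensity_eq_integral_smul hwm]
    refine integral_congr_ae (Eventually.of_forall fun p => ?_)
    simp only [NNReal.smul_def, hwval, Complex.real_smul]
  have hνintR : ∀ g : ℝ → ℝ, Continuous g →
      ∫ x, g x ∂ν = ∫ p, Real.exp (-(t * p 0)) * g (p 1) ∂μ := by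
    intro g hg
    rw [hν, integral_map hπ.aemeasurable hg.aestronglyMeasurable, integral_withDensity_eq_integral_smul hwm]
    refine integral_congr_ae (Eventually.of_forall fun p => ?_)
    simp only [NNReal.smul_def, hwval, smul_eq_mul]
  -- the characteristic function of `ν`
  have hchar : ∀ s : ℝ, |s| < R → h s = charFun ν s := by
    intro s hs
    rw [charFun_apply_real, hνint _ (by fun_prop), heq s hs]
    refine integral_congr_ae (Eventually.of_forall fun p => ?_)
    simp only [Complex.ofReal_exp, ← Complex.exp_add]
    congr 1
    push_cast
    ring
  -- Lukacs
  have hint := integrable_exp_mul_of_charFun_eq hR hh hchar hM hβ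
  have hle := integral_exp_mul_le_of_charFun_eq hR hh hchar hM hβ
  have hback : ∫ x, Real.exp (β * x) ∂ν = ∫ p, Real.exp (-(t * p 0) + β * p 1) ∂μ := by
    rw [hνintR _ (by fun_prop)]
    refine integral_congr_ae (Eventually.of_forall fun p => ?_)
    simp only [← Real.exp_add]
  refine ⟨?_, hback ▸ hle⟩
  rw [hν, integrable_map_measure (by fun_prop) hπ.aemeasurable,
    integrable_withDensity_iff_integrable_smul hwm] at hint
  refine hint.congr (Eventually.of_forall fun p => ?_)
  simp only [Function.comp_apply, NNReal.smul_def, hwval, smul_eq_mul, ← Real.exp_add]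

end Disc

end Literature.Analysis.Complex
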